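import Mathlib
import HarnessLib
import Summits.HubbardSuperconductivity.HubbardSuperconductivity.Theorems.KLProgrammeKLRegimeWickCrossContractionGramLines
import Summits.HubbardSuperconductivity.HubbardSuperconductivity.Theorems.KLProgrammeKLRegimeWickCrossContractionValue

/-!
# Route `KLProgramme` — ENGINE child gen 6 (stmt-HubbardSuperconductivity-20236 `KLRegimeEngineV16`), `stub_engine_step_values` (E2-v10):
# the `k`-line two-vertex term, VALUE form (every output leg fixed) WITH A GRAM TAIL — `e' + 1` explicit lines carrying the sector levels,
# `k − e' − 1` loop lines in a Gram minor, no factorial in `k` (cell gate-hubbard-kl, seat p5 g5; sequel to `…WickCrossContractionGram{,Lines}`)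

p5 g4's `…WickCrossContractionValue` (p511129) reads ALL lines explicitly (line `0` in `L¹`, the others sup × sector-diagonal): right for the E.5
classes `k = 3, 4`, factorially lossy in `k`.  Here the same statements with only the first `e' + 1` lines explicit:

* **`norm_kernel_crossContract_value_le_gram`** — generic lines: `‖kernel ((Δ_×(C_{k−1})∘⋯∘Δ_×(C_0))(a⁰·b¹)) m (Z,s)‖ ≤
  ((k+m₀)!(k+m₁)!/(m!·(k−e'−1)!))·(Σ_s κ_s²)^{k−e'−1}·(c·∏_{i<e'}(d_i r_i)·Na·Nb)`: `c` = row sums of line `0`, `d_i, r_i` = sup × sector-diagonal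
  data of lines `1 … e'`, `κ` = Gram data of lines `e'+1 … k−1`; `Na` bounds `a` with its free legs fixed and ALL its contracted legs summed,
  `Nb` bounds `b` with its line-`0` leg fixed, the sectors of its legs `1 … e'` fixed (positions summed), its Gram legs `e'+1 … k−1` summed ENTIRELY
  and its free legs fixed — `b` at `levelCount = e' + 1 + m₁`;
* **`norm_kernel_crossContract_value_pullback_le_gram`** — lines `S(F)ᵀ·C_{p_i}·S(F)` (overlap `ρ = 4ρ₀` automatic; Gram data = BGM (2.80),
  `Literature.….contr_pullback_normalCovariance_eq_inner`, `κ_i` bounding `‖F_Y‖, ‖G_Y‖` = the sector phase-space sums `norm_sq_sectorGramF/G`);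
* `sum_sum_filter_castLE_norm_kernel_sectorPreimage_le` — the `Nb` of the value form is a sectorised norm at level `e' + 1 + m₁`;
* **`norm_kernel_crossContract_value_sectorPreimage_le_gram`** — the assembled VALUE statement in engine currency: with `(k!)⁻¹` the prefactor is
  `C(k+m₀+1,k)·C(k+m₁,k)·((m₀+1)!m₁!/m!)·k!/(k−e'−1)!` (no `k!`), the lines give `α·∏_{i<e'}(δ_i·4ρ₀)·(Σκ²)^{k−e'−1}`, `Ga` is read at level
  `m₀ + 1`, `Gb` at level `e' + 1 + m₁` (choose `e' = 4 − m₁` for the top of BGM (2.98): `levelGainExp ≥ 2`).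

Generic / engine currency; no definitions, no named facts, nothing about sizes is asserted.  References (locators only): Feldman–Knörrer–Trubowitz,
Commun. Math. Phys. 247 (2004) App. B; Rev. Math. Phys. 15 (2003) §VI, Prop. XII; Benfatto–Giuliani–Mastropietro, Ann. Henri Poincaré 7 (2006) (2.80), (2.98).
-/

noncomputable section

namespace Summit.HubbardSuperconductivity.HubbardSuperconductivity.Theorems.KLRegimeWick

set_option linter.dupNamespace false -- summit = problem name (single-conjunct summit), D-0017

open Literature.MathematicalPhysics.QuantumLattice Literature.Probability.LatticeModels GrassmannAlgebra Finset Matrix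
open Summit.HubbardSuperconductivity.HubbardSuperconductivity.Theorems.KLRegimeSplit
open scoped InnerProductSpace

/-! ## §1 The value form with a Gram tail, generic lines -/

section Value

variable {𝕜 : Type*} [RCLike 𝕜] {E : Type*} [NormedAddCommGroup E] [InnerProductSpace 𝕜 E]
variable {P S : Type*} [Fintype P] [Fintype S] [DecidableEq P] [DecidableEq S] {ι : Type*} [Fintype ι] [DecidableEq ι]

/-- **Value form of the `k`-line two-vertex term with a Gram tail** (every output leg fixed; lines `0 … e'` explicit, `e'+1 … k−1` Gram):
`‖kernel ((Δ_×(C_{k−1})∘⋯∘Δ_×(C_0))(a⁰·b¹)) m (Z,s)‖ ≤ ((k+m₀)!(k+m₁)!/(m!·(k−e'−1)!))·(Σ_s κ_s²)^{k−e'−1}·(c·∏_{i<e'}(d_i r_i)·Na·Nb)`.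
[cite: FeldmanKnorrerTrubowitz2004, App. B] -/
theorem norm_kernel_crossContract_value_le_gram (q : P × S → Bool) (Cg : ι → Matrix (P × S) (P × S) 𝕜)
    (hCg : ∀ s X Y, q X = q Y → Cg s X Y = 0) (f g : ι → P × S → E) (κ : ι → ℝ)
    (hf : ∀ s X, q X = true → ‖f s X‖ ≤ κ s) (hg : ∀ s Y, q Y = false → ‖g s Y‖ ≤ κ s)
    (hG : ∀ s X Y, q X = true → q Y = false → contr 𝕜 (Cg s) X Y = ⟪f s X, g s Y⟫_𝕜)
    {k e' m m₀ m₁ : ℕ} (he : e' + 1 ≤ k) (C : Fin k → Matrix (P × S) (P × S) 𝕜) (τ : Fin k → ι)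
    (hCτ : ∀ i : Fin k, e' + 1 ≤ (i : ℕ) → C i = Cg (τ i))
    (a b : GrassmannAlgebra 𝕜 (P × S)) (s : Fin m → Fin 2) (hm₀ : (univ.filter fun i => s i = 0).card = m₀)
    (hm₁ : (univ.filter fun i => s i = 1).card = m₁) (Z : Fin m → P × S)
    {c : ℝ} (hc0 : 0 ≤ c) (hc : ∀ X, ∑ Y, ‖contr 𝕜 (C (Fin.castLE he 0)) X Y‖ ≤ c)
    (D : Fin e' → S → S → ℝ) (hD : ∀ i σ τ, 0 ≤ D i σ τ) (d r : Fin e' → ℝ) (hd : ∀ i, 0 ≤ d i) (hr0 : ∀ i, 0 ≤ r i)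
    (hLD : ∀ (i : Fin e') (X Y : P × S), ‖contr 𝕜 (C (Fin.castLE he i.succ)) X Y‖ ≤ d i * D i X.2 Y.2) (hr : ∀ i σ, ∑ τ, D i σ τ ≤ r i)
    {Na Nb : ℝ} (hNb0 : 0 ≤ Nb)
    (hNa : ∀ X₀ : Fin m₀ → P × S, ∑ X : Fin k → P × S, ‖kernel 𝕜 a (k + m₀) (Fin.append X X₀)‖ ≤ Na)
    (hNb : ∀ (Y₀ : P × S) (τ' : Fin e' → S) (Y₁ : Fin m₁ → P × S), ∑ y : Fin e' → P,
      ∑ Y ∈ univ.filter (fun Y : Fin k → P × S =>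
        (fun i => Y (Fin.castLE he i)) = (Fin.cons Y₀ (fun i => (y i, τ' i)) : Fin (e' + 1) → P × S)),
          ‖kernel 𝕜 b (k + m₁) (Fin.append Y Y₁)‖ ≤ Nb) :
    ‖kernel 𝕜 (((List.ofFn fun i => grassmannLaplacian 𝕜 (crossCov 𝕜 (C i))).reverse).prod
        (dblCopy 𝕜 0 a * dblCopy 𝕜 1 b)) m (fun i => (Z i, s i))‖ ≤
      (((k + m₀).factorial * (k + m₁).factorial : ℝ) / (m.factorial * (k - (e' + 1)).factorial)) * (∑ s, κ s ^ 2) ^ (k - (e' + 1)) *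
        (c * (∏ i, d i * r i) * Na * Nb) := by
  classical
  obtain ⟨h, σ, ε, h0, h1, hZ⟩ := exists_colouring_equiv (Γ := P × S) s hm₀ hm₁
  refine (norm_kernel_crossContract_le_gram_fiber q Cg hCg f g κ hf hg hG he C τ hCτ a b (fun i => (Z i, s i)) h σ
    (fun j => Z (ε (Sum.inl j))) (fun j => Z (ε (Sum.inr j))) (hZ Z)).trans ?_
  have hK0 : 0 ≤ (∑ s, κ s ^ 2) ^ (k - (e' + 1)) := pow_nonneg (sum_nonneg fun s _ => sq_nonneg (κ s)) _
  refine mul_le_mul_of_nonneg_left ?_ (mul_nonneg (by positivity) hK0)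
  have hNa' : ∑ Xe : Fin (e' + 1) → P × S, ∑ X ∈ univ.filter (fun X : Fin k → P × S => (fun i => X (Fin.castLE he i)) = Xe),
      ‖kernel 𝕜 a (k + m₀) (Fin.append X fun j => Z (ε (Sum.inl j)))‖ ≤ Na := by
    rw [sum_fiberwise]
    exact hNa _
  have hmain := sum_crossContraction_value_le
    (fun Xe : Fin (e' + 1) → P × S => ∑ X ∈ univ.filter (fun X : Fin k → P × S => (fun i => X (Fin.castLE he i)) = Xe),
      ‖kernel 𝕜 a (k + m₀) (Fin.append X fun j => Z (ε (Sum.inl j)))‖)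
    (fun Ye : Fin (e' + 1) → P × S => ∑ Y ∈ univ.filter (fun Y : Fin k → P × S => (fun i => Y (Fin.castLE he i)) = Ye),
      ‖kernel 𝕜 b (k + m₁) (Fin.append Y fun j => Z (ε (Sum.inr j)))‖)
    (fun Xe => sum_nonneg fun _ _ => norm_nonneg _) (fun Ye => sum_nonneg fun _ _ => norm_nonneg _)
    (fun i X Y => ‖contr 𝕜 (C (Fin.castLE he i)) X Y‖) (fun i X Y => norm_nonneg _) hc0 hc D hD d r hd hr0 hLD hr hNb0
    hNa' (fun Y₀ τ' => hNb Y₀ τ' _)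
  refine le_trans (le_of_eq ?_) hmain
  exact sum_congr rfl fun X _ => sum_congr rfl fun Y _ => by ring

end Value

/-! ## §2 Lines `S(F)ᵀ·C_p·S(F)`: overlap and Gram form automatic -/

section Pullback

variable {L M N : ℕ} [NeZero L]

/-- **Value form with a Gram tail for sectorised normal covariances** (one family `F` with at most `ρ₀` overlap partners, symbols `p_0, …, p_{k−1}`;
line `0`: row/column sums `≤ α`; lines `1 … e'`: entries `≤ δ_i`; every line: Gram vectors `F_Y`, `G_Y` (BGM (2.80)) of norm `≤ κ_i` on the legs of
its charge): `‖kernel (…) m (Z,s)‖ ≤ ((k+m₀)!(k+m₁)!/(m!·(k−e'−1)!))·(Σ_i κ_i²)^{k−e'−1}·(α·∏_{i<e'}(δ_i·4ρ₀)·Na·Nb)`.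
[cite: BenfattoGiulianiMastropietro2006, §2.8 (2.80)] -/
theorem norm_kernel_crossContract_value_pullback_le_gram {k e' m m₀ m₁ : ℕ} (he : e' + 1 ≤ k) (β : ℝ) (F : Fin N → FreqMomentum L M → ℂ)
    {ρ₀ : ℕ} (hρ₀ : ∀ ω : Fin N, ((univ : Finset (Fin N)).filter fun ω' => ∃ q, F ω q * F ω' q ≠ 0).card ≤ ρ₀)
    (sym : Fin k → FreqMomentum L M × Fin 2 → ℂ) (κ : Fin k → ℝ)
    (hκF : ∀ (i : Fin k) (Y : SpaceTimeIdx L M × SectorLeg N), Y.2.2 = 0 → ‖sectorGramF L M β F (sym i) Y‖ ≤ κ i)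
    (hκG : ∀ (i : Fin k) (Y : SpaceTimeIdx L M × SectorLeg N), Y.2.2 = 1 → ‖sectorGramG L M β F (sym i) Y‖ ≤ κ i)
    (a b : GrassmannAlgebra ℂ (SpaceTimeIdx L M × SectorLeg N)) (s : Fin m → Fin 2)
    (hm₀ : (univ.filter fun i => s i = 0).card = m₀) (hm₁ : (univ.filter fun i => s i = 1).card = m₁)
    (Z : Fin m → SpaceTimeIdx L M × SectorLeg N) {α : ℝ} (hα : 0 ≤ α)
    (hrow : ∀ X, ∑ Y, ‖((sectorSubMatrix L M β F).transpose * normalCovariance L M (sym (Fin.castLE he 0)) * sectorSubMatrix L M β F) X Y‖ ≤ α)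
    (hcol : ∀ Y, ∑ X, ‖((sectorSubMatrix L M β F).transpose * normalCovariance L M (sym (Fin.castLE he 0)) * sectorSubMatrix L M β F) X Y‖ ≤ α)
    (δ : Fin e' → ℝ) (hδ : ∀ i, 0 ≤ δ i)
    (hent : ∀ (i : Fin e') X Y,
      ‖((sectorSubMatrix L M β F).transpose * normalCovariance L M (sym (Fin.castLE he i.succ)) * sectorSubMatrix L M β F) X Y‖ ≤ δ i)
    {Na Nb : ℝ} (hNb0 : 0 ≤ Nb)
    (hNa : ∀ X₀ : Fin m₀ → SpaceTimeIdx L M × SectorLeg N, ∑ X : Fin k → SpaceTimeIdx L M × SectorLeg N,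
      ‖kernel ℂ a (k + m₀) (Fin.append X X₀)‖ ≤ Na)
    (hNb : ∀ (Y₀ : SpaceTimeIdx L M × SectorLeg N) (τ' : Fin e' → SectorLeg N) (Y₁ : Fin m₁ → SpaceTimeIdx L M × SectorLeg N),
      ∑ y : Fin e' → SpaceTimeIdx L M, ∑ Y ∈ univ.filter (fun Y : Fin k → SpaceTimeIdx L M × SectorLeg N =>
        (fun i => Y (Fin.castLE he i)) = (Fin.cons Y₀ (fun i => (y i, τ' i)) : Fin (e' + 1) → SpaceTimeIdx L M × SectorLeg N)),
          ‖kernel ℂ b (k + m₁) (Fin.append Y Y₁)‖ ≤ Nb) :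
    ‖kernel ℂ (((List.ofFn fun i => grassmannLaplacian ℂ (crossCov ℂ
        ((sectorSubMatrix L M β F).transpose * normalCovariance L M (sym i) * sectorSubMatrix L M β F))).reverse).prod
        (dblCopy ℂ 0 a * dblCopy ℂ 1 b)) m (fun i => (Z i, s i))‖ ≤
      (((k + m₀).factorial * (k + m₁).factorial : ℝ) / (m.factorial * (k - (e' + 1)).factorial)) * (∑ i, κ i ^ 2) ^ (k - (e' + 1)) *
        (α * (∏ i, δ i * ((4 * ρ₀ : ℕ) : ℝ)) * Na * Nb) := by
  classical
  refine norm_kernel_crossContract_value_le_gram (fun Y : SpaceTimeIdx L M × SectorLeg N => decide (Y.2.2 = 0))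
    (fun i => (sectorSubMatrix L M β F).transpose * normalCovariance L M (sym i) * sectorSubMatrix L M β F)
    (fun i X Y hq => pullback_normalCovariance_apply_of_charge_eq β F (sym i) (by
      have h' : X.2.2 = 0 ↔ Y.2.2 = 0 := by simpa using hq
      rw [Fin.ext_iff, Fin.ext_iff, Fin.val_zero] at h'
      rw [Fin.ext_iff]
      have hX2 := X.2.2.isLt
      have hY2 := Y.2.2.isLt
      omega))
    (fun i => sectorGramF L M β F (sym i)) (fun i => sectorGramG L M β F (sym i)) κ
    (fun i X hX => hκF i X (by simpa using hX)) (fun i Y hY => hκG i Y ?_)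
    (fun i X Y hX hY => contr_pullback_normalCovariance_eq_inner β F (sym i) (by simpa using hX) ?_)
    he _ id (fun i _ => rfl) a b s hm₀ hm₁ Z hα (sum_norm_contr_le _ hrow hcol)
    (fun _ σ τ => if (∃ q, F σ.1.1 q * F τ.1.1 q ≠ 0) then (1 : ℝ) else 0) (fun _ σ τ => by positivity)
    δ (fun _ => ((4 * ρ₀ : ℕ) : ℝ)) hδ (fun _ => by positivity)
    (fun i X Y => norm_contr_le_indicator_of_support _ (fun σ τ : SectorLeg N => ∃ q, F σ.1.1 q * F τ.1.1 q ≠ 0)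
      (fun σ τ ⟨q, hq⟩ => ⟨q, by rwa [mul_comm] at hq⟩) (hδ i) (hent i)
      (fun X Y hXY => exists_mul_ne_zero_of_pullback_normalCovariance_ne_zero β F (sym _) hXY) X Y)
    (fun _ σ => sum_indicator_le_of_card_le (fun σ τ : SectorLeg N => ∃ q, F σ.1.1 q * F τ.1.1 q ≠ 0) (fun σ' => ?_) σ) hNb0 hNa hNb
  · have h2 : (Y.2.2 : Fin 2) ≠ 0 := by simpa using hY
    omega
  · have h2 : (Y.2.2 : Fin 2) ≠ 0 := by simpa using hY
    omega
  · exact (card_filter_sectorLeg_le fun ω' => ∃ q, F σ'.1.1 q * F ω' q ≠ 0).trans (Nat.mul_le_mul_left 4 (hρ₀ σ'.1.1))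

end Pullback

/-! ## §3 Engine currency: the vertex sizes of the sector preimage; `Gb` at level `e' + 1 + m₁` -/

section Preimage

variable {L M N : ℕ} [NeZero L]

omit [NeZero L] in
/-- The sector components of `cons Y₀ (y, τ')`. [folklore] -/
private theorem snd_cons_pair {P S : Type*} {e' : ℕ} (Y₀ : P × S) (y : Fin e' → P) (τ' : Fin e' → S) (i : Fin (e' + 1)) :
    ((Fin.cons Y₀ (fun j => (y j, τ' j)) : Fin (e' + 1) → P × S) i).2 = (Fin.cons Y₀.2 τ' : Fin (e' + 1) → S) i := by
  refine Fin.cases ?_ (fun j => ?_) i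
  · simp only [Fin.cons_zero]
  · simp only [Fin.cons_succ]

omit [NeZero L] in
/-- `castLE` of a value-constructed index is that index. [folklore] -/
private theorem castLE_mk_val {k e : ℕ} (he : e ≤ k) (i : Fin k) (h : (i : ℕ) < e) : Fin.castLE he ⟨i, h⟩ = i := Fin.ext rfl

/-- **`Nb` of the value form with a Gram tail is a sectorised norm at level `e' + 1 + m₁`**: `b = sectorPreimage β F G` summed over its legs
with the line-`0` leg FIXED, the sectors of its explicit legs `1 … e'` fixed, its Gram legs free and its free legs fixed is at most
`ε_x·‖G‖_{prescribedTuples univ Ω}`, `Ω = (some Y₀.2, some ∘ τ', none^{k−e'−1}, some ∘ snd ∘ Y₁)`. [folklore] -/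
theorem sum_sum_filter_castLE_norm_kernel_sectorPreimage_le {β : ℝ} (hβ : 0 ≤ β) (F : Fin N → FreqMomentum L M → ℂ)
    (G : HubbardGrassmann L M) {k e' m₁ : ℕ} (he : e' + 1 ≤ k) (Y₀ : SpaceTimeIdx L M × SectorLeg N) (τ' : Fin e' → SectorLeg N)
    (Y₁ : Fin m₁ → SpaceTimeIdx L M × SectorLeg N) :
    ∑ y : Fin e' → SpaceTimeIdx L M, ∑ Y ∈ univ.filter (fun Y : Fin k → SpaceTimeIdx L M × SectorLeg N =>
        (fun i => Y (Fin.castLE he i)) = (Fin.cons Y₀ (fun i => (y i, τ' i)) : Fin (e' + 1) → SpaceTimeIdx L M × SectorLeg N)),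
          ‖kernel ℂ (sectorPreimage β F G) (k + m₁) (Fin.append Y Y₁)‖ ≤
      imagTimeWeight β M * hubbardSectorKernelNorm L M β F (prescribedTuples univ
        (Fin.append (fun i : Fin k => if h : (i : ℕ) < e' + 1 then some ((Fin.cons Y₀.2 τ' : Fin (e' + 1) → SectorLeg N) ⟨i, h⟩) else none)
          (fun j => some (Y₁ j).2))) G := by
  classical
  -- the condition on the explicit legs, without the positions of legs `1 … e'`
  set Sx : Finset (Fin k → SpaceTimeIdx L M × SectorLeg N) := univ.filter fun Y =>
    Y (Fin.castLE he 0) = Y₀ ∧ ∀ i' : Fin (e' + 1), (Y (Fin.castLE he i')).2 = (Fin.cons Y₀.2 τ' : Fin (e' + 1) → SectorLeg N) i' with hSx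
  -- (1) the double sum is the sum over `Sx` (fibred over the positions of legs `1 … e'`)
  have step1 : ∑ y : Fin e' → SpaceTimeIdx L M, ∑ Y ∈ univ.filter (fun Y : Fin k → SpaceTimeIdx L M × SectorLeg N =>
        (fun i => Y (Fin.castLE he i)) = (Fin.cons Y₀ (fun i => (y i, τ' i)) : Fin (e' + 1) → SpaceTimeIdx L M × SectorLeg N)),
          ‖kernel ℂ (sectorPreimage β F G) (k + m₁) (Fin.append Y Y₁)‖ =
      ∑ Y ∈ Sx, ‖kernel ℂ (sectorPreimage β F G) (k + m₁) (Fin.append Y Y₁)‖ := by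
    rw [← sum_fiberwise Sx (fun Y : Fin k → SpaceTimeIdx L M × SectorLeg N => fun j : Fin e' => (Y (Fin.castLE he j.succ)).1)]
    refine sum_congr rfl fun y _ => sum_congr (Finset.ext fun Y => ?_) fun _ _ => rfl
    simp only [hSx, mem_filter, mem_univ, true_and]
    constructor
    · intro hY
      have hYi : ∀ i, Y (Fin.castLE he i) = (Fin.cons Y₀ (fun i => (y i, τ' i)) : Fin (e' + 1) → _) i := fun i => congrFun hY i
      refine ⟨⟨by rw [hYi 0, Fin.cons_zero], fun i' => by rw [hYi i', snd_cons_pair]⟩, funext fun j => by rw [hYi j.succ, Fin.cons_succ]⟩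
    · rintro ⟨⟨h0, hsec⟩, hpos⟩
      funext i
      refine Fin.cases ?_ (fun j => ?_) i
      · rw [h0, Fin.cons_zero]
      · rw [Fin.cons_succ]
        exact Prod.ext (congrFun hpos j) (by rw [hsec j.succ, Fin.cons_succ])
  -- (2) append the fixed free legs: an injection into the prescribed tuples of `Fin (k + m₁)`
  have hinj : Set.InjOn (fun Y : Fin k → SpaceTimeIdx L M × SectorLeg N => Fin.append Y Y₁) ↑Sx := by
    intro Y _ Y' _ hYY'
    funext i
    have h := congrFun hYY' (Fin.castAdd m₁ i)
    simp only [Fin.append_left] at h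
    exact h
  have step2 : ∑ Y ∈ Sx, ‖kernel ℂ (sectorPreimage β F G) (k + m₁) (Fin.append Y Y₁)‖ ≤
      ∑ W ∈ univ.filter (fun W : Fin (k + m₁) → SpaceTimeIdx L M × SectorLeg N => W (Fin.castAdd m₁ (Fin.castLE he 0)) = Y₀ ∧
        ∀ i, ∀ t ∈ (Fin.append (fun i : Fin k => if h : (i : ℕ) < e' + 1 then
          some ((Fin.cons Y₀.2 τ' : Fin (e' + 1) → SectorLeg N) ⟨i, h⟩) else none) (fun j => some (Y₁ j).2) : Fin (k + m₁) → _) i, (W i).2 = t),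
        ‖kernel ℂ (sectorPreimage β F G) (k + m₁) W‖ := by
    rw [← sum_image (f := fun W => ‖kernel ℂ (sectorPreimage β F G) (k + m₁) W‖) hinj]
    refine sum_le_sum_of_subset_of_nonneg (fun W hW => ?_) fun _ _ _ => norm_nonneg _
    obtain ⟨Y, hY, rfl⟩ := mem_image.1 hW
    simp only [hSx, mem_filter, mem_univ, true_and] at hY ⊢
    obtain ⟨h0, hsec⟩ := hY
    refine ⟨by rw [Fin.append_left, h0], fun i => Fin.addCases (fun i' => ?_) (fun j => ?_) i⟩
    · intro t ht
      rw [Fin.append_left] at ht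
      by_cases h : (i' : ℕ) < e' + 1
      · rw [dif_pos h, Option.mem_def, Option.some.injEq] at ht
        rw [Fin.append_left, ← ht, ← hsec ⟨i', h⟩, castLE_mk_val]
      · rw [dif_neg h] at ht
        exact absurd ht (by simp)
    · intro t ht
      simp only [Fin.append_right, Option.mem_def, Option.some.injEq] at ht
      rw [Fin.append_right, ht]
  rw [step1]
  exact step2.trans (sum_filter_prescribed_norm_kernel_sectorPreimage_le hβ F G _ Y₀ _)

/-- **Value form with a Gram tail between two sector preimages, in engine currency**: `Ga` at level `m₀ + 1` (its free legs' sectors prescribed),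
`Gb` at level `e' + 1 + m₁` (its line-`0` leg, its explicit legs `1 … e'` and its free legs prescribed, its `k − e' − 1` Gram legs free):
`‖kernel ((Δ_×(C′_{k−1})∘⋯∘Δ_×(C′_0))((sectorPreimage β F Ga)⁰·(sectorPreimage β F Gb)¹)) m (Z,s)‖
 ≤ ((k+(m₀+1))!(k+m₁)!/(m!·(k−e'−1)!))·(Σ_i κ_i²)^{k−e'−1}·(α·∏_{i<e'}(δ_i·4ρ₀)·(ε_x Na)·(ε_x Nb))`.
[cite: BenfattoGiulianiMastropietro2006, §2.8 (2.80)] -/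
theorem norm_kernel_crossContract_value_sectorPreimage_le_gram {k e' m m₀ m₁ : ℕ} (he : e' + 1 ≤ k) {β : ℝ} (hβ : 0 ≤ β)
    (F : Fin N → FreqMomentum L M → ℂ)
    {ρ₀ : ℕ} (hρ₀ : ∀ ω : Fin N, ((univ : Finset (Fin N)).filter fun ω' => ∃ q, F ω q * F ω' q ≠ 0).card ≤ ρ₀)
    (sym : Fin k → FreqMomentum L M × Fin 2 → ℂ) (κ : Fin k → ℝ)
    (hκF : ∀ (i : Fin k) (Y : SpaceTimeIdx L M × SectorLeg N), Y.2.2 = 0 → ‖sectorGramF L M β F (sym i) Y‖ ≤ κ i)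
    (hκG : ∀ (i : Fin k) (Y : SpaceTimeIdx L M × SectorLeg N), Y.2.2 = 1 → ‖sectorGramG L M β F (sym i) Y‖ ≤ κ i)
    (Ga Gb : HubbardGrassmann L M) (s : Fin m → Fin 2)
    (hm₀ : (univ.filter fun i => s i = 0).card = m₀ + 1) (hm₁ : (univ.filter fun i => s i = 1).card = m₁)
    (Z : Fin m → SpaceTimeIdx L M × SectorLeg N) {α : ℝ} (hα : 0 ≤ α)
    (hrow : ∀ X, ∑ Y, ‖((sectorSubMatrix L M β F).transpose * normalCovariance L M (sym (Fin.castLE he 0)) * sectorSubMatrix L M β F) X Y‖ ≤ α)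
    (hcol : ∀ Y, ∑ X, ‖((sectorSubMatrix L M β F).transpose * normalCovariance L M (sym (Fin.castLE he 0)) * sectorSubMatrix L M β F) X Y‖ ≤ α)
    (δ : Fin e' → ℝ) (hδ : ∀ i, 0 ≤ δ i)
    (hent : ∀ (i : Fin e') X Y,
      ‖((sectorSubMatrix L M β F).transpose * normalCovariance L M (sym (Fin.castLE he i.succ)) * sectorSubMatrix L M β F) X Y‖ ≤ δ i)
    {Na Nb : ℝ} (hNb0 : 0 ≤ Nb)
    (hNa : ∀ σ₀ : Fin (m₀ + 1) → SectorLeg N, hubbardSectorKernelNorm L M β F (prescribedTuples univ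
      (Fin.append (fun _ : Fin k => (none : Option (SectorLeg N))) (fun j => some (σ₀ j)))) Ga ≤ Na)
    (hNb : ∀ (ω₀ : SectorLeg N) (τ' : Fin e' → SectorLeg N) (ω₁ : Fin m₁ → SectorLeg N),
      hubbardSectorKernelNorm L M β F (prescribedTuples univ
        (Fin.append (fun i : Fin k => if h : (i : ℕ) < e' + 1 then some ((Fin.cons ω₀ τ' : Fin (e' + 1) → SectorLeg N) ⟨i, h⟩) else none)
          (fun j => some (ω₁ j)))) Gb ≤ Nb) :
    ‖kernel ℂ (((List.ofFn fun i => grassmannLaplacian ℂ (crossCov ℂ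
        ((sectorSubMatrix L M β F).transpose * normalCovariance L M (sym i) * sectorSubMatrix L M β F))).reverse).prod
        (dblCopy ℂ 0 (sectorPreimage β F Ga) * dblCopy ℂ 1 (sectorPreimage β F Gb))) m (fun i => (Z i, s i))‖ ≤
      (((k + (m₀ + 1)).factorial * (k + m₁).factorial : ℝ) / (m.factorial * (k - (e' + 1)).factorial)) *
        (∑ i, κ i ^ 2) ^ (k - (e' + 1)) *
        (α * (∏ i, δ i * ((4 * ρ₀ : ℕ) : ℝ)) * (imagTimeWeight β M * Na) * (imagTimeWeight β M * Nb)) :=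
  norm_kernel_crossContract_value_pullback_le_gram he β F hρ₀ sym κ hκF hκG (sectorPreimage β F Ga) (sectorPreimage β F Gb) s hm₀ hm₁ Z
    hα hrow hcol δ hδ hent (mul_nonneg (imagTimeWeight_nonneg hβ M) hNb0)
    (fun X₀ => (sum_fixed_norm_kernel_sectorPreimage_le hβ F Ga X₀).trans
      (mul_le_mul_of_nonneg_left (hNa _) (imagTimeWeight_nonneg hβ M)))
    fun Y₀ τ' Y₁ => (sum_sum_filter_castLE_norm_kernel_sectorPreimage_le hβ F Gb he Y₀ τ' Y₁).trans
      (mul_le_mul_of_nonneg_left (hNb _ _ _) (imagTimeWeight_nonneg hβ M))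

end Preimage

end Summit.HubbardSuperconductivity.HubbardSuperconductivity.Theorems.KLRegimeWick

end
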